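import Summits.QuantumFields.YangMills.Theses.BalabanUVNodes
import Summits.QuantumFields.YangMills.Theorems.BalabanUVNodesN27AtShellSplitOfRecord13CoPHVCut

/-!
# BalabanUVNodes ∕ N27 = binder B5 AT THE RECORD, leaf — K3⁷ `Theses.BalabanUVNodes.SpineGivenEndpointR13SepCoPH` IN v3's `PinnedAtLive jc sh cr` SHAPE WITH THE SHELL SPLIT PINNED AT
# dag-n21-d's SHELL SPLIT OF RECORD `sh := shellSplitOfRecord₁₃At 2 K₀ ρA ρB` — N21 ⟸ THE PER-TOP-CUBE (M1) ROWS (p593341) — AND, IN §2, THE CUT AT dag-n20-w2's ZERO CUT — N20 GONE (p590852)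
# (cell `pub-ymgap`, HUMAN RULING D-0062 Track A, R134 seat `pub-ymgap-dag-n27-c` (N27 B5 composite, s2) gen 12, HOME trigger (t2); plan g81 K3⁷ skeleton v3 02f6f498332fdbee;
# `--kind proof --supports stmt-QuantumFields-20544 --as helper`; COUNT-NEUTRAL; THREE theorems, 0 `def`, 0 `sorry`; a route-facing leaf, nothing may import it)

WHAT THIS LEAF DISPLAYS.  THE ITEM (`N = 2`, guard `θ.ZhUnity F 2 ∧ θ.SlotsNondegenerate₁₃ F 2`, `hc := hP.toCore`) from: an ARBITRARY rates predicate `P` at a keyed rate reading `rr` on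
the whole guard (`hrates`; v3's `KeyedRatesHolderD4 β (rrOfRecord 𝔯 ksel)` is `P := PHolderD4 β`, `rr := rrOfRecord 𝔯 ksel`); ON THE LIVE-SELECTOR LINE, at the spine reading
`fun F θ hP g₀ os ↦ crOfRecord₁₃VAt K₀ (jc F θ hP g₀ os) (shellSplitOfRecord₁₃At 2 K₀ ρA ρB) F θ hP g₀ os` (at `K₀ = 0` v3's pinned witness with `sh :=` the split of record): the law `hζm` ((H-U) and `0 ≤ ζ` are THEOREMS at the tuple — K0c `localBgMeasurable`, n20-w2
`zeta_nonneg_of_provisos₁₃CoPH` — supplied in storey X; ⇒ N27x, a theorem), N20 as a keyed `RelWeightBound` witness at the tuple's own cut depth (`h20`; ABSENT in §2 — the zero cut, dag-n20-w2), **N21 as dag-n21-d's displayed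
rows** — width signs `hρA hρB` and per tuple `hM1` = `∃ DA DB ≥ 0`, `Summable (D_K·ρ_K)` per run, and per (run, K, |t| ≤ 1, top cube) the estimate (M1) on the record's truncated dressed laws
(NOT PRINTED, NOT proved) —, and the N19′ edge from `P` to a summable `NE7.Core 1 (F.side ^ 4)` witness at the cores `weightA₁₃ − shellA₁₃ … (ρA …)` ∕ `weightB₁₃ − shellB₁₃ … (ρB …)` (`h19`;
in §2 its good class is ALL of `classSet₁₃`); OFF THE LIVE LINE leaf D's four keyed faces at a free reading `cr'` (`h20' h21' hx' h19'`).  Storey X `…N27AtShellSplitOfRecord13CoPHVCut` §1 ∕ §4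
on `guard ∧ LiveSel`, (P) `spine_rec13CCoPHOn_of_keyedFacesP` at `cr'` on `guard ∧ ¬LiveSel`, U `spine_rec13CCoPHOn_of_split`, XXXVIᶜᵒᵖᴴ `spine_rec13CCoPHOn_iff_forall_guarded`.
* §1 ★★ `spineGivenEndpointR13SepCoPH_of_liveShellSplitOfRecord₁₃VAt_cut_cubeAC_offLive_keyedFacesP` — any per-tuple cut `jc`.
* §2 ★★★ `spineGivenEndpointR13SepCoPH_of_liveShellSplitOfRecord₁₃VAt_cutZero_cubeAC_offLive_keyedFacesP` — the zero cut: on the live line THE ITEM costs EXACTLY the law `hζm`, n21-d's (M1)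
  rows, the rates, and the N19′ core witness on every keyed class at the shells of record (dag-n20-w2 LOCATED-2∕3 + dag-n21-d's face, composed BY NAME at the item).
* §3 ★★★ `spineGivenEndpointR13SepCoPH_of_liveZeroDial₁₃VAt_offLive_keyedFacesP` — the ZERO DIAL `(0, 0)` (N20 ∕ N21 both gone, dag-n20-w2 p590852 ∕ p593923): on the live line THE ITEM
  costs EXACTLY the law `hζm`, the rates, and a summable NE7-PROPER core witness on the FULL keyed class weights of record — n20-w2's LOCATED-2 as one term of the item's type.

HONEST FRAMING.  NOT a discharge: terms of the item's type under displayed hypotheses (audit `proof.conditional`), every one inhabited for no family today (K0⁷ `Record13SepCoPHInhabited`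
OPEN); (M1) per top cube is dag-n21-d's displayed estimate, NOT PRINTED, NOT proved; the width letters `ρA ρB` are LETTERS (A6: the zero width is the junk instance — content only jointly
with N16's closeness widths and N19′'s core); the zero cut is ONE setting of the prover's dial (plan ruling (a)) — N20's ∕ N21's node discharge is booked at the policy the CLOSING proof
uses, never here; NE7 ∕ NE7b ∕ NE7c ∕ NE1′–NE9 NOT PRINTED for d = 4 and NOT PROVED at Bałaban's objects; nothing of Bałaban's asserted or instantiated; N27 COMPOSITE, NOT discharged;
K3⁷ NOT claimed closed; route rev 25 and skeleton v3 UNTOUCHED; counts UNMOVED (typed 28∕28 · discharged 5∕27, A 5∕28); one finite four-torus programme at fixed `ε` — NOT ℝ⁴, NOT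
infinite volume, NOT OS, NOT a mass gap, NOT Clay.  No decl below carries a cite tag.
-/

set_option autoImplicit false

namespace Summit.QuantumFields.YangMills.Theorems.BalabanUVNodesN27SpineRecord

open scoped BigOperators
open Literature.MathematicalPhysics.QuantumFieldTheory.Balaban1983to89
open Literature.MathematicalPhysics.QuantumFieldTheory.Balaban1983to89.T4Continuum
open Literature.MathematicalPhysics.QuantumFieldTheory.Balaban1983to89.Node00
open T4WeightBudget (RelWeightBound)
open T4IndicatorShell (ShellWeightBound)
open T4ContinuumYM4Torus (ForSmallCouplings)
open Summit.QuantumFields.BalabanUV.T4Continuum.Spine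
open Summit.QuantumFields.YangMills.Theses.BalabanUVNodes (SpineGivenEndpointR13SepCoPH)
open YMDAG.UVSplit
open Summit.QuantumFields.YangMills.BalabanUVNodes.N19TargetClassWeightsE1Keyed
open Summit.QuantumFields.YangMills.Theorems.N21ShellSplitOfRecord13CoPH (WidthLetter₁₃CoPH shellSplitOfRecord₁₃At shellA₁₃ shellB₁₃ shellPieceOfDatum₉ cubeWeightOfDatum₉)

variable (K₀ : ℕ) (jc : (F : T4Family) → (θ : Stage13HParams F 2) → θ.Provisos₁₃CoPH F 2 → (ℕ → ℝ) → List (ULoop F) → ℕ → ℕ)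
  (ρA ρB : WidthLetter₁₃CoPH 2)
  (cr' : (F : T4Family) → (θ : Stage13HParams F 2) → θ.Provisos₁₃CoPH F 2 → (ℕ → ℝ) → List (ULoop F) → SpineCarriers)
  (rr : (F : T4Family) → (θ : Stage13HParams F 2) → θ.Provisos₁₃CoPH F 2 → (ℕ → ℝ) → List (ULoop F) → RateCarriers 2)
  (P : ∀ {F : T4Family}, Datum F 2 → RateCarriers 2 → Prop)

/-! ## §1 Any per-tuple cut, the shell split of record: N21 in dag-n21-d's (M1) currency on the live line -/

/-- ★★ **K3⁷ IN v3's `PinnedAtLive` SHAPE AT `(jc, shellSplitOfRecord₁₃At 2 K₀ ρA ρB)`, N21 FROM dag-n21-d's (M1) ROWS** (storey X §1 on `guard ∧ LiveSel`, (P) at `cr'` on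
`guard ∧ ¬LiveSel`, U `spine_rec13CCoPHOn_of_split`, `hc := hP.toCore`).  NOT a discharge: a term of the item's type under displayed hypotheses, each inhabited for no family today; (M1)
NOT PRINTED ∕ NOT proved; `jc`, `ρA`, `ρB` free. [bookkeeping] -/
theorem spineGivenEndpointR13SepCoPH_of_liveShellSplitOfRecord₁₃VAt_cut_cubeAC_offLive_keyedFacesP
    (hrates : ∀ (F : T4Family) (θ : Stage13HParams F 2) (hP : θ.Provisos₁₃CoPH F 2), (θ.ZhUnity F 2 ∧ θ.SlotsNondegenerate₁₃ F 2) → θ.Admissible F 2 → ∀ (g₀ : ℕ → ℝ) (os : List (ULoop F)),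
      P (datumOfRecord₁₃CoPH F 2 θ hP) (rr F θ hP g₀ os))
    (hζm : ∀ (F : T4Family) (θ : Stage13HParams F 2), θ.Provisos₁₃CoPH F 2 → ((θ.ZhUnity F 2 ∧ θ.SlotsNondegenerate₁₃ F 2) ∧ θ.ppSel = ppSelLiveOfRecord F 2 θ.ν θ.τ9 (EOfRecord₁₃ F 2 θ.toStage13Params) (wOfRecord₉ F 2 θ.toStage9Params)) → θ.Admissible F 2 → ZetaMeasurable F 2 θ.ζ)
    (h20 : ∀ (F : T4Family) (θ : Stage13HParams F 2) (hP : θ.Provisos₁₃CoPH F 2), ((θ.ZhUnity F 2 ∧ θ.SlotsNondegenerate₁₃ F 2) ∧ θ.ppSel = ppSelLiveOfRecord F 2 θ.ν θ.τ9 (EOfRecord₁₃ F 2 θ.toStage13Params) (wOfRecord₉ F 2 θ.toStage9Params)) → θ.Admissible F 2 → ∀ (g₀ : ℕ → ℝ) (os : List (ULoop F)),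
      ∃ W : ℕ → ℝ, RelWeightBound 1 (classSet₁₃ θ K₀ g₀) (weightA₁₃ θ hP K₀ g₀ os) (weightB₁₃ θ hP K₀ g₀ os) (badClass₁₃ θ K₀ g₀ (jc F θ hP g₀ os)) W)
    (hρA : ∀ (F : T4Family) (θ : Stage13HParams F 2) (hP : θ.Provisos₁₃CoPH F 2),
      ((θ.ZhUnity F 2 ∧ θ.SlotsNondegenerate₁₃ F 2) ∧ θ.ppSel = ppSelLiveOfRecord F 2 θ.ν θ.τ9 (EOfRecord₁₃ F 2 θ.toStage13Params) (wOfRecord₉ F 2 θ.toStage9Params)) → θ.Admissible F 2 →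
        ∀ (g₀ : ℕ → ℝ) (os : List (ULoop F)) (K : ℕ), 0 ≤ ρA F θ hP g₀ os K)
    (hρB : ∀ (F : T4Family) (θ : Stage13HParams F 2) (hP : θ.Provisos₁₃CoPH F 2),
      ((θ.ZhUnity F 2 ∧ θ.SlotsNondegenerate₁₃ F 2) ∧ θ.ppSel = ppSelLiveOfRecord F 2 θ.ν θ.τ9 (EOfRecord₁₃ F 2 θ.toStage13Params) (wOfRecord₉ F 2 θ.toStage9Params)) → θ.Admissible F 2 →
        ∀ (g₀ : ℕ → ℝ) (os : List (ULoop F)) (K : ℕ), 0 ≤ ρB F θ hP g₀ os K)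
    (hM1 : ∀ (F : T4Family) (θ : Stage13HParams F 2) (hP : θ.Provisos₁₃CoPH F 2),
      ((θ.ZhUnity F 2 ∧ θ.SlotsNondegenerate₁₃ F 2) ∧ θ.ppSel = ppSelLiveOfRecord F 2 θ.ν θ.τ9 (EOfRecord₁₃ F 2 θ.toStage13Params) (wOfRecord₉ F 2 θ.toStage9Params)) → θ.Admissible F 2 →
        ∀ (g₀ : ℕ → ℝ) (os : List (ULoop F)), ∃ DA DB : ℕ → ℝ, (∀ K, 0 ≤ DA K) ∧ (∀ K, 0 ≤ DB K) ∧
          Summable (fun K => DA K * ρA F θ hP g₀ os K) ∧ Summable (fun K => DB K * ρB F θ hP g₀ os K) ∧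
          (∀ (K : ℕ) (t : ℝ), |t| ≤ 1 →
            ∀ a : ↥(cubeIndices (F.P (K₀ + K)) (cubeSide (F.P (K₀ + K)).L θ.ν.M₂ (RkOfRecord (F.P (K₀ + K)).L θ.ν.r (histA₁₃ θ K₀ g₀ K (K₀ + K))) (K₀ + K))),
              ∑ s, shellPieceOfDatum₉ F 2 θ.toStage9Params (datumOfRecord₁₃CoPH F 2 θ hP) g₀ os (runA₁₃ F K₀ g₀ K) (histA₁₃ θ K₀ g₀ K) (K₀ + K)
                  (ρA F θ hP g₀ os K) t a s ≤
                (DA K * ρA F θ hP g₀ os K) *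
                  ∑ s, cubeWeightOfDatum₉ F 2 θ.toStage9Params (datumOfRecord₁₃CoPH F 2 θ hP) g₀ os (runA₁₃ F K₀ g₀ K) (histA₁₃ θ K₀ g₀ K) (K₀ + K) t a s) ∧
          (∀ (K : ℕ) (t : ℝ), |t| ≤ 1 →
            ∀ a : ↥(cubeIndices (F.P (K₀ + K + 1)) (cubeSide (F.P (K₀ + K + 1)).L θ.ν.M₂
                (RkOfRecord (F.P (K₀ + K + 1)).L θ.ν.r (histB₁₃ θ K₀ g₀ K (K₀ + K + 1))) (K₀ + K + 1))),
              ∑ s', shellPieceOfDatum₉ F 2 θ.toStage9Params (datumOfRecord₁₃CoPH F 2 θ hP) g₀ os (runB₁₃ F K₀ g₀ K) (histB₁₃ θ K₀ g₀ K) (K₀ + K + 1)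
                  (ρB F θ hP g₀ os K) t a s' ≤
                (DB K * ρB F θ hP g₀ os K) *
                  ∑ s', cubeWeightOfDatum₉ F 2 θ.toStage9Params (datumOfRecord₁₃CoPH F 2 θ hP) g₀ os (runB₁₃ F K₀ g₀ K) (histB₁₃ θ K₀ g₀ K) (K₀ + K + 1) t a s'))
    (h19 : ∀ (F : T4Family) (θ : Stage13HParams F 2) (hP : θ.Provisos₁₃CoPH F 2), ((θ.ZhUnity F 2 ∧ θ.SlotsNondegenerate₁₃ F 2) ∧ θ.ppSel = ppSelLiveOfRecord F 2 θ.ν θ.τ9 (EOfRecord₁₃ F 2 θ.toStage13Params) (wOfRecord₉ F 2 θ.toStage9Params)) → θ.Admissible F 2 → ∀ (g₀ : ℕ → ℝ) (os : List (ULoop F)),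
      P (datumOfRecord₁₃CoPH F 2 θ hP) (rr F θ hP g₀ os) → letI : DecidableEq (Σ K, SiteSeqKey F (K₀ + K)) := Classical.decEq _
        ∃ δ : ℕ → ℝ, NE7.Core 1 (F.side ^ 4) (classSet₁₃ θ K₀ g₀) (badClass₁₃ θ K₀ g₀ (jc F θ hP g₀ os)) (fun K t x => weightA₁₃ θ hP K₀ g₀ os K t x - shellA₁₃ θ hP K₀ g₀ os (ρA F θ hP g₀ os) K t x)
          (fun K t x => weightB₁₃ θ hP K₀ g₀ os K t x - shellB₁₃ θ hP K₀ g₀ os (ρB F θ hP g₀ os) K t x) δ ∧ Summable δ)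
    (h20' : ∀ (F : T4Family) (θ : Stage13HParams F 2) (hP : θ.Provisos₁₃CoPH F 2), ((θ.ZhUnity F 2 ∧ θ.SlotsNondegenerate₁₃ F 2) ∧ ¬ θ.ppSel = ppSelLiveOfRecord F 2 θ.ν θ.τ9 (EOfRecord₁₃ F 2 θ.toStage13Params) (wOfRecord₉ F 2 θ.toStage9Params)) → θ.Admissible F 2 → ∀ (g₀ : ℕ → ℝ) (os : List (ULoop F)),
      RelWeightBound (cr' F θ hP g₀ os).l₀ (cr' F θ hP g₀ os).T (cr' F θ hP g₀ os).A (cr' F θ hP g₀ os).B (cr' F θ hP g₀ os).Bad (cr' F θ hP g₀ os).W)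
    (h21' : ∀ (F : T4Family) (θ : Stage13HParams F 2) (hP : θ.Provisos₁₃CoPH F 2), ((θ.ZhUnity F 2 ∧ θ.SlotsNondegenerate₁₃ F 2) ∧ ¬ θ.ppSel = ppSelLiveOfRecord F 2 θ.ν θ.τ9 (EOfRecord₁₃ F 2 θ.toStage13Params) (wOfRecord₉ F 2 θ.toStage9Params)) → θ.Admissible F 2 → ∀ (g₀ : ℕ → ℝ) (os : List (ULoop F)),
      ShellWeightBound (cr' F θ hP g₀ os).l₀ (cr' F θ hP g₀ os).T (cr' F θ hP g₀ os).A (cr' F θ hP g₀ os).B (cr' F θ hP g₀ os).shA (cr' F θ hP g₀ os).shB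
        (cr' F θ hP g₀ os).Wsh)
    (hx' : ∀ (F : T4Family) (θ : Stage13HParams F 2) (hP : θ.Provisos₁₃CoPH F 2), ((θ.ZhUnity F 2 ∧ θ.SlotsNondegenerate₁₃ F 2) ∧ ¬ θ.ppSel = ppSelLiveOfRecord F 2 θ.ν θ.τ9 (EOfRecord₁₃ F 2 θ.toStage13Params) (wOfRecord₉ F 2 θ.toStage9Params)) → θ.Admissible F 2 →
      B16.EndStatementBPrinted (datumOfRecord₁₃CoPH F 2 θ hP).C → DagBinding.EndpointExistence (datumOfRecord₁₃CoPH F 2 θ hP).C.toB12 →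
        ForSmallCouplings (datumOfRecord₁₃CoPH F 2 θ hP) fun g₀ => ∀ os : List (ULoop F),
          0 < (cr' F θ hP g₀ os).l₀ ∧ 0 < (cr' F θ hP g₀ os).vol ∧
          (∀ (K : ℕ) (t : ℝ), |t| ≤ (cr' F θ hP g₀ os).l₀ →
            T4GenFunBounds.schemeZ ((datumOfRecord₁₃CoPH F 2 θ hP).scheme g₀) os ((cr' F θ hP g₀ os).K₀ + K) t =
              ∑ τ ∈ (cr' F θ hP g₀ os).T K, (cr' F θ hP g₀ os).A K t τ) ∧
          (∀ (K : ℕ) (t : ℝ), |t| ≤ (cr' F θ hP g₀ os).l₀ →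
            T4GenFunBounds.schemeZ ((datumOfRecord₁₃CoPH F 2 θ hP).scheme g₀) os ((cr' F θ hP g₀ os).K₀ + K + 1) t =
              ∑ τ ∈ (cr' F θ hP g₀ os).T K, (cr' F θ hP g₀ os).B K t τ))
    (h19' : ∀ (F : T4Family) (θ : Stage13HParams F 2) (hP : θ.Provisos₁₃CoPH F 2), ((θ.ZhUnity F 2 ∧ θ.SlotsNondegenerate₁₃ F 2) ∧ ¬ θ.ppSel = ppSelLiveOfRecord F 2 θ.ν θ.τ9 (EOfRecord₁₃ F 2 θ.toStage13Params) (wOfRecord₉ F 2 θ.toStage9Params)) → θ.Admissible F 2 → ∀ (g₀ : ℕ → ℝ) (os : List (ULoop F)),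
      P (datumOfRecord₁₃CoPH F 2 θ hP) (rr F θ hP g₀ os) → letI := (cr' F θ hP g₀ os).dec
        ∃ δ : ℕ → ℝ, NE7.Core (cr' F θ hP g₀ os).l₀ (cr' F θ hP g₀ os).vol (cr' F θ hP g₀ os).T (cr' F θ hP g₀ os).Bad
          (fun K t τ => (cr' F θ hP g₀ os).A K t τ - (cr' F θ hP g₀ os).shA K t τ) (fun K t τ => (cr' F θ hP g₀ os).B K t τ - (cr' F θ hP g₀ os).shB K t τ) δ ∧
          Summable δ) :
    SpineGivenEndpointR13SepCoPH :=
  fun F θ hP hG hθ _ _ =>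
    (spine_rec13CCoPHOn_iff_forall_guarded (fun F θ => θ.ZhUnity F 2 ∧ θ.SlotsNondegenerate₁₃ F 2)).mp
      (spine_rec13CCoPHOn_of_split (fun F θ => θ.ZhUnity F 2 ∧ θ.SlotsNondegenerate₁₃ F 2)
        (fun F (θ : Stage13HParams F 2) => θ.ppSel = ppSelLiveOfRecord F 2 θ.ν θ.τ9 (EOfRecord₁₃ F 2 θ.toStage13Params) (wOfRecord₉ F 2 θ.toStage9Params))
        (spine_rec13CCoPHOn_live_at_shellSplitOfRecord₁₃VAt_cut_of_keyedFacesP_cubeAC K₀ jc ρA ρB (fun F θ => θ.ZhUnity F 2 ∧ θ.SlotsNondegenerate₁₃ F 2) rr P hζm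
          h20 hρA hρB hM1 (fun F θ hP hRg hθ => hrates F θ hP hRg.1 hθ) h19)
        (spine_rec13CCoPHOn_of_keyedFacesP (cr := cr') (rr := rr)
          (Rg := fun F θ => (θ.ZhUnity F 2 ∧ θ.SlotsNondegenerate₁₃ F 2) ∧ ¬ θ.ppSel = ppSelLiveOfRecord F 2 θ.ν θ.τ9 (EOfRecord₁₃ F 2 θ.toStage13Params) (wOfRecord₉ F 2 θ.toStage9Params)) (P := P)
          h20' h21' (fun F θ hP hRg hθ => hrates F θ hP hRg.1 hθ) h19' hx'))
      F θ hP.toCore hG hθ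

/-! ## §2 The zero cut AND the shell split of record: N20 gone (dag-n20-w2), N21 in the (M1) currency — what THE ITEM costs there, BY NAME -/

/-- ★★★ **K3⁷ IN v3's `PinnedAtLive` SHAPE AT THE DIAL `(0, shellSplitOfRecord₁₃At 2 K₀ ρA ρB)`: N20 DISCHARGED (dag-n20-w2 `relWeightBound_carriers₁₃_cutZero`), N21 ⟸ dag-n21-d's (M1)
ROWS, N27x A THEOREM** — on the live line THE ITEM asks EXACTLY: the law `hζm` (`ZetaMeasurable`), the width signs, the per-tuple (M1) data, the rates `P` at `rr`, and the N19′ edge from them to a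
summable `NE7.Core 1 (F.side ^ 4)` witness comparing the two runs' cores at the shells of record on EVERY keyed class (`badClass₁₃ θ K₀ g₀ (fun _ ↦ 0) = ∅`, n20-w2); off the live line leaf
D's faces at `cr'` (storey X §4, (P), U's split).  The last live binder is NE7 proper (NOT PRINTED for d = 4, NOT proved) — displayed, not claimed; the dial setting books nothing.
[bookkeeping] -/
theorem spineGivenEndpointR13SepCoPH_of_liveShellSplitOfRecord₁₃VAt_cutZero_cubeAC_offLive_keyedFacesP
    (hrates : ∀ (F : T4Family) (θ : Stage13HParams F 2) (hP : θ.Provisos₁₃CoPH F 2), (θ.ZhUnity F 2 ∧ θ.SlotsNondegenerate₁₃ F 2) → θ.Admissible F 2 → ∀ (g₀ : ℕ → ℝ) (os : List (ULoop F)),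
      P (datumOfRecord₁₃CoPH F 2 θ hP) (rr F θ hP g₀ os))
    (hζm : ∀ (F : T4Family) (θ : Stage13HParams F 2), θ.Provisos₁₃CoPH F 2 → ((θ.ZhUnity F 2 ∧ θ.SlotsNondegenerate₁₃ F 2) ∧ θ.ppSel = ppSelLiveOfRecord F 2 θ.ν θ.τ9 (EOfRecord₁₃ F 2 θ.toStage13Params) (wOfRecord₉ F 2 θ.toStage9Params)) → θ.Admissible F 2 → ZetaMeasurable F 2 θ.ζ)
    (hρA : ∀ (F : T4Family) (θ : Stage13HParams F 2) (hP : θ.Provisos₁₃CoPH F 2),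
      ((θ.ZhUnity F 2 ∧ θ.SlotsNondegenerate₁₃ F 2) ∧ θ.ppSel = ppSelLiveOfRecord F 2 θ.ν θ.τ9 (EOfRecord₁₃ F 2 θ.toStage13Params) (wOfRecord₉ F 2 θ.toStage9Params)) → θ.Admissible F 2 →
        ∀ (g₀ : ℕ → ℝ) (os : List (ULoop F)) (K : ℕ), 0 ≤ ρA F θ hP g₀ os K)
    (hρB : ∀ (F : T4Family) (θ : Stage13HParams F 2) (hP : θ.Provisos₁₃CoPH F 2),
      ((θ.ZhUnity F 2 ∧ θ.SlotsNondegenerate₁₃ F 2) ∧ θ.ppSel = ppSelLiveOfRecord F 2 θ.ν θ.τ9 (EOfRecord₁₃ F 2 θ.toStage13Params) (wOfRecord₉ F 2 θ.toStage9Params)) → θ.Admissible F 2 →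
        ∀ (g₀ : ℕ → ℝ) (os : List (ULoop F)) (K : ℕ), 0 ≤ ρB F θ hP g₀ os K)
    (hM1 : ∀ (F : T4Family) (θ : Stage13HParams F 2) (hP : θ.Provisos₁₃CoPH F 2),
      ((θ.ZhUnity F 2 ∧ θ.SlotsNondegenerate₁₃ F 2) ∧ θ.ppSel = ppSelLiveOfRecord F 2 θ.ν θ.τ9 (EOfRecord₁₃ F 2 θ.toStage13Params) (wOfRecord₉ F 2 θ.toStage9Params)) → θ.Admissible F 2 →
        ∀ (g₀ : ℕ → ℝ) (os : List (ULoop F)), ∃ DA DB : ℕ → ℝ, (∀ K, 0 ≤ DA K) ∧ (∀ K, 0 ≤ DB K) ∧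
          Summable (fun K => DA K * ρA F θ hP g₀ os K) ∧ Summable (fun K => DB K * ρB F θ hP g₀ os K) ∧
          (∀ (K : ℕ) (t : ℝ), |t| ≤ 1 →
            ∀ a : ↥(cubeIndices (F.P (K₀ + K)) (cubeSide (F.P (K₀ + K)).L θ.ν.M₂ (RkOfRecord (F.P (K₀ + K)).L θ.ν.r (histA₁₃ θ K₀ g₀ K (K₀ + K))) (K₀ + K))),
              ∑ s, shellPieceOfDatum₉ F 2 θ.toStage9Params (datumOfRecord₁₃CoPH F 2 θ hP) g₀ os (runA₁₃ F K₀ g₀ K) (histA₁₃ θ K₀ g₀ K) (K₀ + K)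
                  (ρA F θ hP g₀ os K) t a s ≤
                (DA K * ρA F θ hP g₀ os K) *
                  ∑ s, cubeWeightOfDatum₉ F 2 θ.toStage9Params (datumOfRecord₁₃CoPH F 2 θ hP) g₀ os (runA₁₃ F K₀ g₀ K) (histA₁₃ θ K₀ g₀ K) (K₀ + K) t a s) ∧
          (∀ (K : ℕ) (t : ℝ), |t| ≤ 1 →
            ∀ a : ↥(cubeIndices (F.P (K₀ + K + 1)) (cubeSide (F.P (K₀ + K + 1)).L θ.ν.M₂
                (RkOfRecord (F.P (K₀ + K + 1)).L θ.ν.r (histB₁₃ θ K₀ g₀ K (K₀ + K + 1))) (K₀ + K + 1))),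
              ∑ s', shellPieceOfDatum₉ F 2 θ.toStage9Params (datumOfRecord₁₃CoPH F 2 θ hP) g₀ os (runB₁₃ F K₀ g₀ K) (histB₁₃ θ K₀ g₀ K) (K₀ + K + 1)
                  (ρB F θ hP g₀ os K) t a s' ≤
                (DB K * ρB F θ hP g₀ os K) *
                  ∑ s', cubeWeightOfDatum₉ F 2 θ.toStage9Params (datumOfRecord₁₃CoPH F 2 θ hP) g₀ os (runB₁₃ F K₀ g₀ K) (histB₁₃ θ K₀ g₀ K) (K₀ + K + 1) t a s'))
    (h19 : ∀ (F : T4Family) (θ : Stage13HParams F 2) (hP : θ.Provisos₁₃CoPH F 2), ((θ.ZhUnity F 2 ∧ θ.SlotsNondegenerate₁₃ F 2) ∧ θ.ppSel = ppSelLiveOfRecord F 2 θ.ν θ.τ9 (EOfRecord₁₃ F 2 θ.toStage13Params) (wOfRecord₉ F 2 θ.toStage9Params)) → θ.Admissible F 2 → ∀ (g₀ : ℕ → ℝ) (os : List (ULoop F)),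
      P (datumOfRecord₁₃CoPH F 2 θ hP) (rr F θ hP g₀ os) → letI : DecidableEq (Σ K, SiteSeqKey F (K₀ + K)) := Classical.decEq _
        ∃ δ : ℕ → ℝ, NE7.Core 1 (F.side ^ 4) (classSet₁₃ θ K₀ g₀) (badClass₁₃ θ K₀ g₀ (fun _ => 0)) (fun K t x => weightA₁₃ θ hP K₀ g₀ os K t x - shellA₁₃ θ hP K₀ g₀ os (ρA F θ hP g₀ os) K t x)
          (fun K t x => weightB₁₃ θ hP K₀ g₀ os K t x - shellB₁₃ θ hP K₀ g₀ os (ρB F θ hP g₀ os) K t x) δ ∧ Summable δ)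
    (h20' : ∀ (F : T4Family) (θ : Stage13HParams F 2) (hP : θ.Provisos₁₃CoPH F 2), ((θ.ZhUnity F 2 ∧ θ.SlotsNondegenerate₁₃ F 2) ∧ ¬ θ.ppSel = ppSelLiveOfRecord F 2 θ.ν θ.τ9 (EOfRecord₁₃ F 2 θ.toStage13Params) (wOfRecord₉ F 2 θ.toStage9Params)) → θ.Admissible F 2 → ∀ (g₀ : ℕ → ℝ) (os : List (ULoop F)),
      RelWeightBound (cr' F θ hP g₀ os).l₀ (cr' F θ hP g₀ os).T (cr' F θ hP g₀ os).A (cr' F θ hP g₀ os).B (cr' F θ hP g₀ os).Bad (cr' F θ hP g₀ os).W)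
    (h21' : ∀ (F : T4Family) (θ : Stage13HParams F 2) (hP : θ.Provisos₁₃CoPH F 2), ((θ.ZhUnity F 2 ∧ θ.SlotsNondegenerate₁₃ F 2) ∧ ¬ θ.ppSel = ppSelLiveOfRecord F 2 θ.ν θ.τ9 (EOfRecord₁₃ F 2 θ.toStage13Params) (wOfRecord₉ F 2 θ.toStage9Params)) → θ.Admissible F 2 → ∀ (g₀ : ℕ → ℝ) (os : List (ULoop F)),
      ShellWeightBound (cr' F θ hP g₀ os).l₀ (cr' F θ hP g₀ os).T (cr' F θ hP g₀ os).A (cr' F θ hP g₀ os).B (cr' F θ hP g₀ os).shA (cr' F θ hP g₀ os).shB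
        (cr' F θ hP g₀ os).Wsh)
    (hx' : ∀ (F : T4Family) (θ : Stage13HParams F 2) (hP : θ.Provisos₁₃CoPH F 2), ((θ.ZhUnity F 2 ∧ θ.SlotsNondegenerate₁₃ F 2) ∧ ¬ θ.ppSel = ppSelLiveOfRecord F 2 θ.ν θ.τ9 (EOfRecord₁₃ F 2 θ.toStage13Params) (wOfRecord₉ F 2 θ.toStage9Params)) → θ.Admissible F 2 →
      B16.EndStatementBPrinted (datumOfRecord₁₃CoPH F 2 θ hP).C → DagBinding.EndpointExistence (datumOfRecord₁₃CoPH F 2 θ hP).C.toB12 →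
        ForSmallCouplings (datumOfRecord₁₃CoPH F 2 θ hP) fun g₀ => ∀ os : List (ULoop F),
          0 < (cr' F θ hP g₀ os).l₀ ∧ 0 < (cr' F θ hP g₀ os).vol ∧
          (∀ (K : ℕ) (t : ℝ), |t| ≤ (cr' F θ hP g₀ os).l₀ →
            T4GenFunBounds.schemeZ ((datumOfRecord₁₃CoPH F 2 θ hP).scheme g₀) os ((cr' F θ hP g₀ os).K₀ + K) t =
              ∑ τ ∈ (cr' F θ hP g₀ os).T K, (cr' F θ hP g₀ os).A K t τ) ∧
          (∀ (K : ℕ) (t : ℝ), |t| ≤ (cr' F θ hP g₀ os).l₀ →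
            T4GenFunBounds.schemeZ ((datumOfRecord₁₃CoPH F 2 θ hP).scheme g₀) os ((cr' F θ hP g₀ os).K₀ + K + 1) t =
              ∑ τ ∈ (cr' F θ hP g₀ os).T K, (cr' F θ hP g₀ os).B K t τ))
    (h19' : ∀ (F : T4Family) (θ : Stage13HParams F 2) (hP : θ.Provisos₁₃CoPH F 2), ((θ.ZhUnity F 2 ∧ θ.SlotsNondegenerate₁₃ F 2) ∧ ¬ θ.ppSel = ppSelLiveOfRecord F 2 θ.ν θ.τ9 (EOfRecord₁₃ F 2 θ.toStage13Params) (wOfRecord₉ F 2 θ.toStage9Params)) → θ.Admissible F 2 → ∀ (g₀ : ℕ → ℝ) (os : List (ULoop F)),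
      P (datumOfRecord₁₃CoPH F 2 θ hP) (rr F θ hP g₀ os) → letI := (cr' F θ hP g₀ os).dec
        ∃ δ : ℕ → ℝ, NE7.Core (cr' F θ hP g₀ os).l₀ (cr' F θ hP g₀ os).vol (cr' F θ hP g₀ os).T (cr' F θ hP g₀ os).Bad
          (fun K t τ => (cr' F θ hP g₀ os).A K t τ - (cr' F θ hP g₀ os).shA K t τ) (fun K t τ => (cr' F θ hP g₀ os).B K t τ - (cr' F θ hP g₀ os).shB K t τ) δ ∧
          Summable δ) :
    SpineGivenEndpointR13SepCoPH :=
  fun F θ hP hG hθ _ _ =>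
    (spine_rec13CCoPHOn_iff_forall_guarded (fun F θ => θ.ZhUnity F 2 ∧ θ.SlotsNondegenerate₁₃ F 2)).mp
      (spine_rec13CCoPHOn_of_split (fun F θ => θ.ZhUnity F 2 ∧ θ.SlotsNondegenerate₁₃ F 2)
        (fun F (θ : Stage13HParams F 2) => θ.ppSel = ppSelLiveOfRecord F 2 θ.ν θ.τ9 (EOfRecord₁₃ F 2 θ.toStage13Params) (wOfRecord₉ F 2 θ.toStage9Params))
        (spine_rec13CCoPHOn_live_at_shellSplitOfRecord₁₃VAt_cutZero_of_keyedFacesP_cubeAC K₀ ρA ρB (fun F θ => θ.ZhUnity F 2 ∧ θ.SlotsNondegenerate₁₃ F 2) rr P hζm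
          hρA hρB hM1 (fun F θ hP hRg hθ => hrates F θ hP hRg.1 hθ) h19)
        (spine_rec13CCoPHOn_of_keyedFacesP (cr := cr') (rr := rr)
          (Rg := fun F θ => (θ.ZhUnity F 2 ∧ θ.SlotsNondegenerate₁₃ F 2) ∧ ¬ θ.ppSel = ppSelLiveOfRecord F 2 θ.ν θ.τ9 (EOfRecord₁₃ F 2 θ.toStage13Params) (wOfRecord₉ F 2 θ.toStage9Params)) (P := P)
          h20' h21' (fun F θ hP hRg hθ => hrates F θ hP hRg.1 hθ) h19' hx'))
      F θ hP.toCore hG hθ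


/-! ## §3 The ZERO DIAL `(jc, sh) = (0, 0)`: N20 AND N21 gone (dag-n20-w2) — dag-n20-w2's LOCATED-2 composed at THE ITEM -/

/-- ★★★ **K3⁷ IN v3's `PinnedAtLive` SHAPE AT THE ZERO DIAL `(0, 0)`: N20 AND N21 DISCHARGED (dag-n20-w2 `relWeightBound_carriers₁₃_cutZero` p590852 ∕ `shellWeightBound_carriers₁₃_shellZero`
p593923), N27x A THEOREM** — on the live line THE ITEM asks EXACTLY: the law `hζm` (`ZetaMeasurable`), the rates `P` at `rr` (`hrates`), and the N19′ edge from them to a summable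
`NE7.Core 1 (F.side ^ 4)` witness comparing the two runs' FULL keyed class weights `weightA₁₃ ∕ weightB₁₃` of record on EVERY keyed class (no cut, no shell allowance); off the live line leaf
D's faces at `cr'` (storey X §5, (P), U's split).  «What stub 2 costs at the cheapest dial» (n20-w2 LOCATED-2, plan g81 honesty paragraph) as ONE term of the item's type: the last live
binder is ONE-STEP NE7 PROPER, term class by term class — NOT PRINTED for d = 4, NOT proved; displayed, not claimed; the dial setting books nothing for N20 ∕ N21.  (Reading-level twin of
the two carrier faces used here: dag-n20-w1's bundle `N20ZeroDialFacesAtRecord13CoPHV.faces_crOfRecord₁₃VAt_zeroDial_of_live`, p≈02:00Z 2026-08-28 — cited, not imported.) [bookkeeping] -/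
theorem spineGivenEndpointR13SepCoPH_of_liveZeroDial₁₃VAt_offLive_keyedFacesP
    (hrates : ∀ (F : T4Family) (θ : Stage13HParams F 2) (hP : θ.Provisos₁₃CoPH F 2), (θ.ZhUnity F 2 ∧ θ.SlotsNondegenerate₁₃ F 2) → θ.Admissible F 2 → ∀ (g₀ : ℕ → ℝ) (os : List (ULoop F)),
      P (datumOfRecord₁₃CoPH F 2 θ hP) (rr F θ hP g₀ os))
    (hζm : ∀ (F : T4Family) (θ : Stage13HParams F 2), θ.Provisos₁₃CoPH F 2 → ((θ.ZhUnity F 2 ∧ θ.SlotsNondegenerate₁₃ F 2) ∧ θ.ppSel = ppSelLiveOfRecord F 2 θ.ν θ.τ9 (EOfRecord₁₃ F 2 θ.toStage13Params) (wOfRecord₉ F 2 θ.toStage9Params)) → θ.Admissible F 2 → ZetaMeasurable F 2 θ.ζ)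
    (h19 : ∀ (F : T4Family) (θ : Stage13HParams F 2) (hP : θ.Provisos₁₃CoPH F 2), ((θ.ZhUnity F 2 ∧ θ.SlotsNondegenerate₁₃ F 2) ∧ θ.ppSel = ppSelLiveOfRecord F 2 θ.ν θ.τ9 (EOfRecord₁₃ F 2 θ.toStage13Params) (wOfRecord₉ F 2 θ.toStage9Params)) → θ.Admissible F 2 → ∀ (g₀ : ℕ → ℝ) (os : List (ULoop F)),
      P (datumOfRecord₁₃CoPH F 2 θ hP) (rr F θ hP g₀ os) → letI : DecidableEq (Σ K, SiteSeqKey F (K₀ + K)) := Classical.decEq _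
        ∃ δ : ℕ → ℝ, NE7.Core 1 (F.side ^ 4) (classSet₁₃ θ K₀ g₀) (badClass₁₃ θ K₀ g₀ (fun _ => 0)) (weightA₁₃ θ hP K₀ g₀ os) (weightB₁₃ θ hP K₀ g₀ os) δ ∧ Summable δ)
    (h20' : ∀ (F : T4Family) (θ : Stage13HParams F 2) (hP : θ.Provisos₁₃CoPH F 2), ((θ.ZhUnity F 2 ∧ θ.SlotsNondegenerate₁₃ F 2) ∧ ¬ θ.ppSel = ppSelLiveOfRecord F 2 θ.ν θ.τ9 (EOfRecord₁₃ F 2 θ.toStage13Params) (wOfRecord₉ F 2 θ.toStage9Params)) → θ.Admissible F 2 → ∀ (g₀ : ℕ → ℝ) (os : List (ULoop F)),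
      RelWeightBound (cr' F θ hP g₀ os).l₀ (cr' F θ hP g₀ os).T (cr' F θ hP g₀ os).A (cr' F θ hP g₀ os).B (cr' F θ hP g₀ os).Bad (cr' F θ hP g₀ os).W)
    (h21' : ∀ (F : T4Family) (θ : Stage13HParams F 2) (hP : θ.Provisos₁₃CoPH F 2), ((θ.ZhUnity F 2 ∧ θ.SlotsNondegenerate₁₃ F 2) ∧ ¬ θ.ppSel = ppSelLiveOfRecord F 2 θ.ν θ.τ9 (EOfRecord₁₃ F 2 θ.toStage13Params) (wOfRecord₉ F 2 θ.toStage9Params)) → θ.Admissible F 2 → ∀ (g₀ : ℕ → ℝ) (os : List (ULoop F)),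
      ShellWeightBound (cr' F θ hP g₀ os).l₀ (cr' F θ hP g₀ os).T (cr' F θ hP g₀ os).A (cr' F θ hP g₀ os).B (cr' F θ hP g₀ os).shA (cr' F θ hP g₀ os).shB
        (cr' F θ hP g₀ os).Wsh)
    (hx' : ∀ (F : T4Family) (θ : Stage13HParams F 2) (hP : θ.Provisos₁₃CoPH F 2), ((θ.ZhUnity F 2 ∧ θ.SlotsNondegenerate₁₃ F 2) ∧ ¬ θ.ppSel = ppSelLiveOfRecord F 2 θ.ν θ.τ9 (EOfRecord₁₃ F 2 θ.toStage13Params) (wOfRecord₉ F 2 θ.toStage9Params)) → θ.Admissible F 2 →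
      B16.EndStatementBPrinted (datumOfRecord₁₃CoPH F 2 θ hP).C → DagBinding.EndpointExistence (datumOfRecord₁₃CoPH F 2 θ hP).C.toB12 →
        ForSmallCouplings (datumOfRecord₁₃CoPH F 2 θ hP) fun g₀ => ∀ os : List (ULoop F),
          0 < (cr' F θ hP g₀ os).l₀ ∧ 0 < (cr' F θ hP g₀ os).vol ∧
          (∀ (K : ℕ) (t : ℝ), |t| ≤ (cr' F θ hP g₀ os).l₀ →
            T4GenFunBounds.schemeZ ((datumOfRecord₁₃CoPH F 2 θ hP).scheme g₀) os ((cr' F θ hP g₀ os).K₀ + K) t =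
              ∑ τ ∈ (cr' F θ hP g₀ os).T K, (cr' F θ hP g₀ os).A K t τ) ∧
          (∀ (K : ℕ) (t : ℝ), |t| ≤ (cr' F θ hP g₀ os).l₀ →
            T4GenFunBounds.schemeZ ((datumOfRecord₁₃CoPH F 2 θ hP).scheme g₀) os ((cr' F θ hP g₀ os).K₀ + K + 1) t =
              ∑ τ ∈ (cr' F θ hP g₀ os).T K, (cr' F θ hP g₀ os).B K t τ))
    (h19' : ∀ (F : T4Family) (θ : Stage13HParams F 2) (hP : θ.Provisos₁₃CoPH F 2), ((θ.ZhUnity F 2 ∧ θ.SlotsNondegenerate₁₃ F 2) ∧ ¬ θ.ppSel = ppSelLiveOfRecord F 2 θ.ν θ.τ9 (EOfRecord₁₃ F 2 θ.toStage13Params) (wOfRecord₉ F 2 θ.toStage9Params)) → θ.Admissible F 2 → ∀ (g₀ : ℕ → ℝ) (os : List (ULoop F)),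
      P (datumOfRecord₁₃CoPH F 2 θ hP) (rr F θ hP g₀ os) → letI := (cr' F θ hP g₀ os).dec
        ∃ δ : ℕ → ℝ, NE7.Core (cr' F θ hP g₀ os).l₀ (cr' F θ hP g₀ os).vol (cr' F θ hP g₀ os).T (cr' F θ hP g₀ os).Bad
          (fun K t τ => (cr' F θ hP g₀ os).A K t τ - (cr' F θ hP g₀ os).shA K t τ) (fun K t τ => (cr' F θ hP g₀ os).B K t τ - (cr' F θ hP g₀ os).shB K t τ) δ ∧
          Summable δ) :
    SpineGivenEndpointR13SepCoPH :=
  fun F θ hP hG hθ _ _ =>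
    (spine_rec13CCoPHOn_iff_forall_guarded (fun F θ => θ.ZhUnity F 2 ∧ θ.SlotsNondegenerate₁₃ F 2)).mp
      (spine_rec13CCoPHOn_of_split (fun F θ => θ.ZhUnity F 2 ∧ θ.SlotsNondegenerate₁₃ F 2)
        (fun F (θ : Stage13HParams F 2) => θ.ppSel = ppSelLiveOfRecord F 2 θ.ν θ.τ9 (EOfRecord₁₃ F 2 θ.toStage13Params) (wOfRecord₉ F 2 θ.toStage9Params))
        (spine_rec13CCoPHOn_live_at_crOfRecord₁₃VAt_zeroDial_of_keyedFacesP K₀ (fun F θ => θ.ZhUnity F 2 ∧ θ.SlotsNondegenerate₁₃ F 2) rr P hζm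
          (fun F θ hP hRg hθ => hrates F θ hP hRg.1 hθ) h19)
        (spine_rec13CCoPHOn_of_keyedFacesP (cr := cr') (rr := rr)
          (Rg := fun F θ => (θ.ZhUnity F 2 ∧ θ.SlotsNondegenerate₁₃ F 2) ∧ ¬ θ.ppSel = ppSelLiveOfRecord F 2 θ.ν θ.τ9 (EOfRecord₁₃ F 2 θ.toStage13Params) (wOfRecord₉ F 2 θ.toStage9Params)) (P := P)
          h20' h21' (fun F θ hP hRg hθ => hrates F θ hP hRg.1 hθ) h19' hx'))
      F θ hP.toCore hG hθ

end Summit.QuantumFields.YangMills.Theorems.BalabanUVNodesN27SpineRecord
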